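import Literature.AnabelianGeometry.SemiGraphs.EdgeSectionBasePoint
import Literature.AnabelianGeometry.SemiGraphs.EdgeBasePointTransport
import Literature.AnabelianGeometry.Anabelioids.ExactFunctorProofs

/-!
# Vertex + branch alignment make the EDGE section map a monomorphism
# ([SemiAnbd] Def. 2.2 (i) p. 23, Rem. 2.2.1 p. 24, Rem. 2.4.2 p. 26)

Mochizuki, *Semi-graphs of anabelioids*, Publ. RIMS **42** (2006) 221–322, §2 [cite: MochizukiSemiAnbd2006, Rem. 2.2.1 p.24].

PROOF-ONLY companion (abc-iut cell, layer L3; FACT-LIST row F-1478 / (J1), brick (L-σ) at EDGES = (E-σ),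
final assembly; seat abc-iut-w4-d079).  For a covering `ψ : ℋ → 𝒦` which is VERTEX-ALIGNED and
BRANCH-ALIGNED, with a global witness (`αψ`, `e_ψ`), a local vertex witness at `w ↦ u` on `P ↪ A_u`
(`α_w`, `e_w`) and a local edge witness at the edge `e′` of a branch `b′ ↦ b` abutting to `w`, on a CONNECTED
`Q ↪ A_f` (`f` the edge of `b`; `α_{e′}`, `e_{e′}` in the presentation `Hom.edgeMap_edgeOf_of_branchMap`):
the edge section map `σ_{e′} : Q ⟶ A_f` of the comparison `K_{e′} = αψ ⋙ ρ_{e′} ⋙ α_{e′}⁻¹` (written out via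
`OverStar.sectionMap` with the evident identification, `EdgeSectionBasePoint`) is a MONOMORPHISM:

* `Hom.range_autMulEquivOfIso_refl_comp` — bookkeeping: conjugating by `Iso.refl` does not change a range;
* `Hom.IsBranchAligned.sectionMapE_mono` — **`Mono σ_{e′}`**: `map_sectionMapE_basePoint_std` (the section
  sends the local edge base point `q₀` to the edge global point), `globalBasePoint_edge_eq_transport`
  ((T-α): that point is the transport `F_f(ψ_b)(alignIso⁻¹ a₀)`), abc-iut-f-161's
  `IsBranchAligned.edge_stabilizer_eq_of_global` (its stabiliser is that of `q₀`) and
  `mono_of_stabilizer_le` (`VertexAlignedStabilizers`).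

Every edge of a connected semi-graph with a vertex has a branch, so together with the vertex statement
(`VertexAlignedSectionMono`, behind abc-iut-w5-d041's `FiniteEtaleCoveringLocalGlobalSection`) this covers
all constituents.  No `def`, no new `Prop`; nothing here takes a side on [IUTchIII] Cor. 3.12.
-/

namespace Literature.AnabelianGeometry.SemiGraphs

namespace SemiGraphOfAnabelioids

namespace Hom

open CategoryTheory CategoryTheory.Limits CategoryTheory.PreGaloisCategory
open Literature.AnabelianGeometry.Anabelioids

universe v₁ u₁ u

variable {ℋ 𝒦 : SemiGraphOfAnabelioids.{v₁, u₁, u}}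

/-- Conjugating by the identity isomorphism of a basepoint does not change the image of a homomorphism
into its automorphism group. [cite: MochizukiGeoAn2004, Def. 1.1.2(ii) p.10] -/
theorem range_autMulEquivOfIso_refl_comp {C : Type*} [Category C] {G : Type*} [Group G]
    (X : C) (h : G →* Aut X) :
    ((Aut.autMulEquivOfIso (Iso.refl X)).toMonoidHom.comp h).range = h.range := by
  ext y
  simp only [MonoidHom.mem_range, MonoidHom.coe_comp, Function.comp_apply, MulEquiv.coe_toMonoidHom]
  constructor
  · rintro ⟨z, rfl⟩
    exact ⟨z, Iso.ext (by simp [Aut.autMulEquivOfIso])⟩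
  · rintro ⟨z, rfl⟩
    exact ⟨z, Iso.ext (by simp [Aut.autMulEquivOfIso])⟩

set_option backward.isDefEq.respectTransparency false in
/-- **(E-σ) The edge section map is a monomorphism.**  Let `ψ : ℋ → 𝒦` be branch-aligned and
vertex-aligned; `A ∈ B(𝒦)` with a global witness `αψ : B(𝒦)_{/A} ⥲ B(ℋ)`, `e_ψ : ψ^* ≅ (A × −) ⋙ αψ`; a branch
`b′` of `ℋ` abutting to `w`, over `b` (abutting to `u = ψ w`, edge `f`); a local vertex witness
`α_w : (𝒦_u)_{/P} ⥲ ℋ_w`, `e_w`, on `P ↪ A_u`; a local edge witness `α_{e′} : (𝒦_f)_{/Q} ⥲ ℋ_{e′}`, `e_{e′}`, on a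
CONNECTED `Q ↪ A_f`.  Then the section map `σ_{e′} : Q ⟶ A_f` of `K_{e′} = αψ ⋙ ρ_{e′} ⋙ α_{e′}⁻¹` with its
evident identification (`EdgeSectionBasePoint`) is a monomorphism — for any choice `hT` of the
terminality witness of `K_{e′}(𝟙_A)`. [cite: MochizukiSemiAnbd2006, Rem. 2.2.1 p.24] -/
theorem IsBranchAligned.sectionMapE_mono {ψ : Hom ℋ 𝒦} (hal : ψ.IsBranchAligned)
    (hva : ψ.IsVertexAligned) (A : 𝒦.BObj) [HasBinaryProducts 𝒦.BObj]
    (αψ : Over A ⥤ ℋ.BObj) [αψ.IsEquivalence] (eψ : ψ.pullbackFunctor ≅ Over.star A ⋙ αψ)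
    (w : ℋ.graph.Vertex) (b' : ℋ.graph.Branch) (h' : ℋ.graph.abuts b' = some w)
    (b : 𝒦.graph.Branch) (p : ψ.base.branchMap b' = b)
    {P : 𝒦.V (ψ.base.vertexMap w)} (mP : P ⟶ A.S (ψ.base.vertexMap w)) [Mono mP]
    (αw : Over P ⥤ ℋ.V w) [αw.IsEquivalence] (ew : (ψ.φV w).pullback ≅ Over.star P ⋙ αw)
    {Q : 𝒦.E (𝒦.graph.edgeOf b)} [PreGaloisCategory.IsConnected Q]
    (mQ : Q ⟶ A.T (𝒦.graph.edgeOf b)) [Mono mQ]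
    (αE : Over Q ⥤ ℋ.E (ℋ.graph.edgeOf b')) [αE.IsEquivalence]
    (eEloc : (ψ.φE (ℋ.graph.edgeOf b') (𝒦.graph.edgeOf b) (ψ.edgeMap_edgeOf_of_branchMap b' b p)).pullback
      ≅ Over.star Q ⋙ αE)
    (hT : IsTerminal ((αψ ⋙ ℋ.ρE (ℋ.graph.edgeOf b') ⋙ αE.inv).obj (Over.mk (𝟙 A)))) :
    Mono (OverStar.sectionMap (Over.forgetAdjStar A) (Over.forgetAdjStar Q)
      (αψ ⋙ ℋ.ρE (ℋ.graph.edgeOf b') ⋙ αE.inv) (𝒦.ρE (𝒦.graph.edgeOf b))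
      (Functor.isoWhiskerRight eψ.symm (ℋ.ρE (ℋ.graph.edgeOf b') ⋙ αE.inv) ≪≫
        Functor.isoWhiskerRight (ψ.reindexIso (ℋ.graph.edgeOf b') (ψ.base.edgeMap (ℋ.graph.edgeOf b'))
          (𝒦.graph.edgeOf b) rfl (ψ.edgeMap_edgeOf_of_branchMap b' b p)) αE.inv ≪≫
        Functor.isoWhiskerLeft (𝒦.ρE (𝒦.graph.edgeOf b)) (Functor.isoWhiskerRight eEloc αE.inv) ≪≫
        Functor.isoWhiskerLeft (𝒦.ρE (𝒦.graph.edgeOf b) ⋙ Over.star Q) αE.asEquivalence.unitIso.symm :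
          Over.star A ⋙ (αψ ⋙ ℋ.ρE (ℋ.graph.edgeOf b') ⋙ αE.inv) ≅
            𝒦.ρE (𝒦.graph.edgeOf b) ⋙ Over.star Q) hT) := by
  -- basepoints: `F_{e′}` of `ℋ_{e′}`, `F′ := b′^* ⋙ F_{e′}` (identity frame), the induced `F`, `F_f`
  obtain ⟨Fe', ⟨hFe'⟩⟩ := GaloisCategory.hasFiberFunctor (C := ℋ.E (ℋ.graph.edgeOf b'))
  let F' : ℋ.V w ⥤ FintypeCat.{v₁} := (ℋ.pull b' w h').pullback ⋙ Fe'
  haveI : FiberFunctor F' := fiberFunctor_comp_of_exact _ Fe'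
  let F : 𝒦.V (ψ.base.vertexMap w) ⥤ FintypeCat.{v₁} := (ψ.φV w).pullback ⋙ F'
  haveI : FiberFunctor F := fiberFunctor_comp_of_exact _ F'
  let R := (ψ.φE (ℋ.graph.edgeOf b') (𝒦.graph.edgeOf b) (ψ.edgeMap_edgeOf_of_branchMap b' b p)).pullback
  let FE : 𝒦.E (𝒦.graph.edgeOf b) ⥤ FintypeCat.{v₁} := R ⋙ Fe'
  haveI : FiberFunctor FE := fiberFunctor_comp_of_exact _ Fe'
  obtain ⟨eTV⟩ := nonempty_equiv_fiber_terminal_punit F'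
  obtain ⟨eTE⟩ := nonempty_equiv_fiber_terminal_punit Fe'
  -- one-point fibres of the global terminal object `αψ 𝟙_A` at `w` and at `e′`
  obtain ⟨-, hρ, hρE⟩ := ℋ.hasLimitsOfShape_bObj (J := Discrete PEmpty.{1})
  haveI := hρ w
  haveI := hρE (ℋ.graph.edgeOf b')
  have hTA : IsTerminal (αψ.obj (Over.mk (𝟙 A))) := Over.mkIdTerminal.isTerminalObj αψ _
  let iV : (ℋ.ρ w).obj (αψ.obj (Over.mk (𝟙 A))) ≅ ⊤_ (ℋ.V w) :=
    (hTA.isTerminalObj (ℋ.ρ w) _).uniqueUpToIso terminalIsTerminal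
  let iE : (ℋ.ρE (ℋ.graph.edgeOf b')).obj (αψ.obj (Over.mk (𝟙 A))) ≅ ⊤_ (ℋ.E (ℋ.graph.edgeOf b')) :=
    (hTA.isTerminalObj (ℋ.ρE (ℋ.graph.edgeOf b')) _).uniqueUpToIso terminalIsTerminal
  haveI hsV : Subsingleton (F'.obj ((αψ.obj (Over.mk (𝟙 A))).S w)) :=
    ((FintypeCat.equivEquivIso.symm (F'.mapIso iV)).trans eTV).subsingleton
  haveI : Subsingleton ((ℋ.ρ w ⋙ F').obj (αψ.obj (Over.mk (𝟙 A)))) := hsV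
  haveI hsE : Subsingleton (Fe'.obj ((αψ.obj (Over.mk (𝟙 A))).T (ℋ.graph.edgeOf b'))) :=
    ((FintypeCat.equivEquivIso.symm (Fe'.mapIso iE)).trans eTE).subsingleton
  haveI : Subsingleton ((ℋ.ρE (ℋ.graph.edgeOf b') ⋙ Fe').obj (αψ.obj (Over.mk (𝟙 A)))) := hsE
  let tV : (ℋ.ρ w ⋙ F').obj (αψ.obj (Over.mk (𝟙 A))) :=
    (FintypeCat.equivEquivIso.symm (F'.mapIso iV)).symm (eTV.symm PUnit.unit)
  let tE : (ℋ.ρE (ℋ.graph.edgeOf b') ⋙ Fe').obj (αψ.obj (Over.mk (𝟙 A))) :=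
    (FintypeCat.equivEquivIso.symm (Fe'.mapIso iE)).symm (eTE.symm PUnit.unit)
  -- one-point fibres of the local terminal objects `α_w 𝟙_P`, `α_{e′} 𝟙_Q`
  let iP : αw.obj (Over.mk (𝟙 P)) ≅ ⊤_ (ℋ.V w) :=
    (Over.mkIdTerminal.isTerminalObj αw _).uniqueUpToIso terminalIsTerminal
  haveI : Subsingleton (F'.obj (αw.obj (Over.mk (𝟙 P)))) :=
    ((FintypeCat.equivEquivIso.symm (F'.mapIso iP)).trans eTV).subsingleton
  let t'V : F'.obj (αw.obj (Over.mk (𝟙 P))) :=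
    (FintypeCat.equivEquivIso.symm (F'.mapIso iP)).symm (eTV.symm PUnit.unit)
  let iQ : αE.obj (Over.mk (𝟙 Q)) ≅ ⊤_ (ℋ.E (ℋ.graph.edgeOf b')) :=
    (Over.mkIdTerminal.isTerminalObj αE _).uniqueUpToIso terminalIsTerminal
  haveI : Subsingleton (Fe'.obj (αE.obj (Over.mk (𝟙 Q)))) :=
    ((FintypeCat.equivEquivIso.symm (Fe'.mapIso iQ)).trans eTE).subsingleton
  let t'E : Fe'.obj (αE.obj (Over.mk (𝟙 Q))) :=
    (FintypeCat.equivEquivIso.symm (Fe'.mapIso iQ)).symm (eTE.symm PUnit.unit)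
  -- (D1) three times: global at the vertex basepoint, local at `w`, local at `e′`
  haveI : PreservesLimitsOfShape WalkingCospan (ℋ.ρ w) := preservesPullbacks_ρ ℋ w
  haveI : PreservesLimitsOfShape WalkingCospan (ℋ.ρ w ⋙ F') := inferInstance
  haveI : (ℋ.ρ w ⋙ F').PreservesMonomorphisms := inferInstance
  have ha := range_pi1Map_eq_stabilizer' αψ eψ (ℋ.ρ w ⋙ F')
    (Functor.isoWhiskerLeft (𝒦.ρ (ψ.base.vertexMap w)) (Iso.refl F)) tV
  have hp := range_pi1Map_eq_stabilizer' αw ew F' (Iso.refl F) t'V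
  have hq := range_pi1Map_eq_stabilizer' αE eEloc Fe' (Iso.refl FE) t'E
  rw [range_autMulEquivOfIso_refl_comp] at hq
  -- the section sends `q₀` to the edge global point, which is the transport of the vertex one
  have key := map_sectionMapE_basePoint_std ψ A αψ eψ (ℋ.graph.edgeOf b') (𝒦.graph.edgeOf b)
    (ψ.edgeMap_edgeOf_of_branchMap b' b p) Q αE eEloc hT Fe' FE (Iso.refl FE) tE t'E
  have hTα := ψ.globalBasePoint_edge_eq_transport A αψ eψ w F' b' h' b p Fe' (Iso.refl F') tV tE
  have hst := hal.edge_stabilizer_eq_of_global hva w F' b' h' b p Fe' (Iso.refl F') _ ha mP _ hp mQ _ hq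
  let q₀ : FE.obj Q := (Iso.refl FE).hom.app Q
    (Fe'.map (αE.map ((Over.forgetAdjStar Q).unit.app (Over.mk (𝟙 Q))) ≫ eEloc.inv.app Q) t'E)
  refine mono_of_stabilizer_le FE _ q₀ ?_
  exact ((congrArg (MulAction.stabilizer (Aut FE)) (key.trans hTα)).trans hst).le

end Hom

end SemiGraphOfAnabelioids

end Literature.AnabelianGeometry.SemiGraphs
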